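/-
Origin: expansion seat `planner-pub-hodgecm-toy-g5-0`, handover #9 2026-08-18T15:57:52Z (md5 2a83bcbc) (`HOME/pub-hodgecm-toy-g5/lean/ToyG5/NumericalRadical3.lean`, md5 2a83bcbc, 169 lines);
landed by the gen-8 packager in gate run 31 as `HodgeCM/Model/ToyG2/NumericalRadical3.lean` (import ^import ToyG5\.HodgeRiemannRational3[ \t]*$→import HodgeCM.Model.ToyG2.HodgeRiemannRational3 ×1).
-/
-- HANDOVER (planner-pub-hodgecm-toy-g5-0, unit pub-hodgecm-toy-g5): WIP module `ToyG5.NumericalRadical3`; intended final module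
-- `HodgeCM.Model.ToyG2.NumericalRadical3` (kind L5, toy model / consistency witness, EXPANSION part (e), generation 5);
-- rename `import ToyG5.X` ↦ `import HodgeCM.Model.ToyG2.X` (one import: `HodgeRiemannRational3`, file #5 of this seat).
/-
Copyright (c) 2026. All rights reserved.
Released under Apache 2.0 license as described in the file LICENSE.
-/
import Mathlib
import Summits.HodgeConjecture.HodgeCM.Model.ToyG2.HodgeRiemannRational3

/-!
# The numerical radical is a two-sided ideal; `N_ℚ = leftRad P_Γ 2 2`; HR20 forces `N_ℂ ∩ F² = 0`

File #9 of generation 5 of the toy lineage (seat `planner-pub-hodgecm-toy-g5-0`) — toolkit for the generation-6 "numerical quotient"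
of `toyUniverse₃` (design memo: `HOME/pub-hodgecm-toy-g5/HANDOFF.md`).

* §1 (toy category, any `X : Obj₂`): the left radicals `leftRad X i j = {y | ∀ c, tr_X(y ∧ c) = 0}` of the trace pairings
  (`HodgeCM.Model.ToyG2.GysinPlan`) form a TWO-SIDED IDEAL of the exterior algebra:
  `hr3n_wedge_mem_leftRad_left` (`x ∈ leftRad X i (j + k) ⇒ x ∧ y ∈ leftRad X (i + j) k`) and `hr3n_wedge_mem_leftRad_right`
  (`x ∈ leftRad X i (k + j) ⇒ y ∧ x ∈ leftRad X (j + i) k`), from associativity and graded symmetry of the trace pairing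
  (`RadicalProd.trOf_wedge_assoc`, `trOf_wedge_comm`); and `hr3n_mem_leftRad_zero_iff` (`leftRad X i 0 = ker tr_X` in degree `i`).
* §2 (toy, any `d t`): **`hr3n_trCupRad_eq_leftRad`** — the radical `N_ℚ = Universe.trCupRad _ P_Γ 2` of files #5–#8 IS `leftRad P_Γ 2 2`,
  so the generation-2/3 radical machinery (`RadKilled`, `GenRadKilled`, `leftRad_eq_bot_of_isBlockFree`, …) applies to it; the ideal
  property for `N_ℚ`: `hr3n_rad_wedge_mem_leftRad` (`x ∈ N_ℚ`, `y ∈ ⋀^j H¹`, `j + k = 2` ⇒ `x ∧ y ∈ leftRad (2+j) k ∋ y ∧ x`); the degree-4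
  numerical quotient **`hr3n_H4_quot_equiv : H⁴(P_Γ, ℚ) ⧸ ker tr ≃ₗ[ℚ] ℚ`** and `hr3n_ker_tr4_eq_leftRad` (`ker tr = leftRad P_Γ 4 0`).
* §3 (GENERIC `Universe`): **`Universe.radC_inf_F2_eq_bot_of_hodgeRiemann20`** — in ANY universe satisfying `Fact_hodgeRiemann20`, for
  every surface `X` the complexified numerical radical of `H²(X)` meets `F²H²(X)` trivially (`(ℂ ⊗ N_ℚ) ⊓ F² = ⊥`): a model of HR20 must have
  its degree-2 numerical radical free of `(2,0)`-classes — the necessary condition that `toyUniverse₃` violates (file #2 `hr3_kernelBlock`)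
  and that the numerical quotient restores by construction; contrapositive `Universe.not_hodgeRiemann20_of_rad_F2`.

Nothing cited, nothing posited, no unfinished proofs.
-/

open scoped TensorProduct
open Literature.AlgebraicGeometry.Motives
open Literature.AlgebraicGeometry.Motives.HodgeStructure (conj)

namespace HodgeCM

noncomputable section

/-! ### §1 The left radicals form a two-sided ideal (toy category, any object) -/

namespace ToyG2

open HodgeCM.Toy HodgeCM.Toy.CMPresentation exteriorPower Obj₂

/-- left ideal property: `x ∈ leftRad X i (j + k)`, `y ∈ ⋀^j` ⇒ `x ∧ y ∈ leftRad X (i + j) k` (associativity) -/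
theorem hr3n_wedge_mem_leftRad_left (X : Obj₂) {i j k : ℕ} {x : ⋀[ℚ]^i X.L} (hx : x ∈ leftRad X i (j + k))
    (y : ⋀[ℚ]^j X.L) : wedge ℚ X.L i j x y ∈ leftRad X (i + j) k := by
  rw [mem_leftRad]
  intro c
  rw [trOf_wedge_assoc]
  exact (mem_leftRad.mp hx) _

/-- right ideal property: `x ∈ leftRad X i (k + j)`, `y ∈ ⋀^j` ⇒ `y ∧ x ∈ leftRad X (j + i) k` (associativity and graded symmetry) -/
theorem hr3n_wedge_mem_leftRad_right (X : Obj₂) {i j k : ℕ} {x : ⋀[ℚ]^i X.L} (hx : x ∈ leftRad X i (k + j))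
    (y : ⋀[ℚ]^j X.L) : wedge ℚ X.L j i y x ∈ leftRad X (j + i) k := by
  rw [mem_leftRad]
  intro c
  rw [trOf_wedge_assoc, trOf_wedge_comm, trOf_wedge_assoc, (mem_leftRad.mp hx) _, mul_zero]

/-- in complementary degree `0` the left radical is the kernel of the trace: `y ∈ leftRad X i 0 ↔ tr_X(y) = 0` -/
theorem hr3n_mem_leftRad_zero_iff (X : Obj₂) {i : ℕ} (y : ⋀[ℚ]^i X.L) : y ∈ leftRad X i 0 ↔ trOf X i y = 0 := by
  rw [mem_leftRad]
  have key : ∀ c : ⋀[ℚ]^0 X.L, trOf X (i + 0) (wedge ℚ X.L i 0 y c) = trOf X (i + 0) (wedge ℚ X.L i 0 y (one0 ℚ X.L)) * 0 +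
      (Classical.choose (exists_eq_smul_one0 c)) * trOf X i y := by
    intro c
    have hc := Classical.choose_spec (exists_eq_smul_one0 c)
    rw [mul_zero, zero_add]
    conv_lhs => rw [hc]
    rw [map_smul, map_smul, smul_eq_mul,
      trOf_congr X (add_zero i) (z := wedge ℚ X.L i 0 y (one0 ℚ X.L)) (z' := y)
        (by rw [wedge_coe, one0_coe, mul_one])]
  constructor
  · intro h
    have h1 := h (one0 ℚ X.L)
    rwa [trOf_congr X (add_zero i) (z := wedge ℚ X.L i 0 y (one0 ℚ X.L)) (z' := y)
      (by rw [wedge_coe, one0_coe, mul_one])] at h1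
  · intro h c
    rw [key c, h, mul_zero, mul_zero, zero_add]

/-! ### §2 `N_ℚ = leftRad P_Γ 2 2`, the ideal property in `H⁴(P_Γ)`, and `H⁴(P_Γ) ⧸ ker tr ≅ ℚ` (toy, any `d t`) -/

open ThetaUiso

variable (d t : ℚ) {L : CMField} (ι₁ : L →+* ℂ) {V : HermSpace3 L ι₁} (Γ : Level V)

/-- **the radical of files #5–#8 is the generation-2 left radical**: `Universe.trCupRad _ P_Γ 2 = leftRad P_Γ 2 2` -/
theorem hr3n_trCupRad_eq_leftRad :
    (toyUniverse₃ d t).trCupRad ((toyUniverse₃ d t).pms L ι₁ V Γ) 2 = leftRad ((toyUniverse₃ d t).pms L ι₁ V Γ).X 2 2 := by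
  ext x
  rw [Universe.mem_trCupRad_iff, mem_leftRad]
  rfl

/-- **`N_ℚ` generates a two-sided ideal inside the numerical radicals**: for `x ∈ N_ℚ` and `y ∈ ⋀^j H¹(P_Γ)`, `j + k = 2`,
`x ∧ y ∈ leftRad P_Γ (2 + j) k` and `y ∧ x ∈ leftRad P_Γ (j + 2) k` (any `d t`) -/
theorem hr3n_rad_wedge_mem_leftRad {j k : ℕ} (hjk : j + k = 2)
    {x : (toyUniverse₃ d t).Coh ((toyUniverse₃ d t).pms L ι₁ V Γ) 2}
    (hx : x ∈ (toyUniverse₃ d t).trCupRad ((toyUniverse₃ d t).pms L ι₁ V Γ) 2)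
    (y : ⋀[ℚ]^j ((toyUniverse₃ d t).pms L ι₁ V Γ).X.L) :
    wedge ℚ ((toyUniverse₃ d t).pms L ι₁ V Γ).X.L 2 j x y ∈ leftRad ((toyUniverse₃ d t).pms L ι₁ V Γ).X (2 + j) k ∧
      wedge ℚ ((toyUniverse₃ d t).pms L ι₁ V Γ).X.L j 2 y x ∈ leftRad ((toyUniverse₃ d t).pms L ι₁ V Γ).X (j + 2) k := by
  rw [hr3n_trCupRad_eq_leftRad] at hx
  have hx1 : x ∈ leftRad ((toyUniverse₃ d t).pms L ι₁ V Γ).X 2 (j + k) := by rw [hjk]; exact hx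
  have hx2 : x ∈ leftRad ((toyUniverse₃ d t).pms L ι₁ V Γ).X 2 (k + j) := by rw [add_comm, hjk]; exact hx
  exact ⟨hr3n_wedge_mem_leftRad_left _ hx1 y, hr3n_wedge_mem_leftRad_right _ hx2 y⟩

/-- the trace of `P_Γ` in degree 4 is onto `ℚ` -/
theorem hr3n_tr4_surjective :
    Function.Surjective ((toyUniverse₃ d t).tr ((toyUniverse₃ d t).pms L ι₁ V Γ) 4) := by
  have hne := toyUniverse₃_tr_pms_ne_zero d t L ι₁ V Γ
  obtain ⟨c, hc⟩ : ∃ c, (toyUniverse₃ d t).tr ((toyUniverse₃ d t).pms L ι₁ V Γ) 4 c ≠ 0 := by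
    by_contra h
    exact hne (LinearMap.ext fun c => not_ne_iff.1 (not_exists.1 h c))
  intro r
  refine ⟨(r / (toyUniverse₃ d t).tr ((toyUniverse₃ d t).pms L ι₁ V Γ) 4 c) • c, ?_⟩
  rw [map_smul, smul_eq_mul, div_mul_cancel₀ r hc]

/-- **the degree-4 numerical quotient is `ℚ`**: `H⁴(P_Γ, ℚ) ⧸ ker tr ≃ₗ[ℚ] ℚ`, induced by the trace (any `d t`) -/
def hr3n_H4_quot_equiv :
    ((toyUniverse₃ d t).Coh ((toyUniverse₃ d t).pms L ι₁ V Γ) 4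
      ⧸ LinearMap.ker ((toyUniverse₃ d t).tr ((toyUniverse₃ d t).pms L ι₁ V Γ) 4)) ≃ₗ[ℚ] ℚ :=
  LinearMap.quotKerEquivOfSurjective _ (hr3n_tr4_surjective d t ι₁ Γ)

/-- (Ported verbatim from the HodgeCMPerL package; no docstring in the source.) -/
theorem hr3n_H4_quot_equiv_mkQ (c : (toyUniverse₃ d t).Coh ((toyUniverse₃ d t).pms L ι₁ V Γ) 4) :
    hr3n_H4_quot_equiv d t ι₁ Γ
        ((LinearMap.ker ((toyUniverse₃ d t).tr ((toyUniverse₃ d t).pms L ι₁ V Γ) 4)).mkQ c)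
      = (toyUniverse₃ d t).tr ((toyUniverse₃ d t).pms L ι₁ V Γ) 4 c :=
  LinearMap.quotKerEquivOfSurjective_apply_mk _ _ c

/-- the kernel of the trace in degree 4 is the left radical `leftRad P_Γ 4 0` -/
theorem hr3n_ker_tr4_eq_leftRad :
    LinearMap.ker ((toyUniverse₃ d t).tr ((toyUniverse₃ d t).pms L ι₁ V Γ) 4)
      = leftRad ((toyUniverse₃ d t).pms L ι₁ V Γ).X 4 0 := by
  ext c
  rw [LinearMap.mem_ker, hr3n_mem_leftRad_zero_iff]
  rfl

end ToyG2

/-! ### §3 HR20 forces the numerical radical of a surface to have no `(2,0)`-part (generic `Universe`) -/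

namespace Universe

variable (U : Universe)

/-- **necessary condition for HR20**: if `U` satisfies `Fact_hodgeRiemann20`, then for every surface `X` the complexified radical
`ℂ ⊗ N_ℚ` of the rational pairing `tr(x ∪ y)` on `H²(X)` meets `F²H²(X)` trivially -/
theorem radC_inf_F2_eq_bot_of_hodgeRiemann20 (h : U.Fact_hodgeRiemann20) (X : U.Var) (hX : U.dim X = 2) :
    (U.trCupRad X 2).baseChange ℂ ⊓ (U.hodge X 2).F 2 = ⊥ := by
  refine (Submodule.eq_bot_iff _).mpr fun η hη => ?_
  obtain ⟨hN, hF⟩ := Submodule.mem_inf.mp hη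
  by_contra h0
  have hrad : ∀ z, U.trC X (2 + 2) (U.cup2C X 2 η z) = 0 := (U.isRadicalC_iff_mem_baseChange X 2 η).mpr hN
  have h4 : U.trC X 4 (U.cup2C X 2 η (conj η)) = 0 := hrad (conj η)
  exact h X hX η hF h0 h4

/-- contrapositive: a surface with a nonzero `(2,0)`-class (`F²`-class) in the complexified numerical radical refutes HR20 -/
theorem not_hodgeRiemann20_of_rad_F2 (X : U.Var) (hX : U.dim X = 2) (η : U.CohC X 2)
    (hN : η ∈ (U.trCupRad X 2).baseChange ℂ) (hF : η ∈ (U.hodge X 2).F 2) (h0 : η ≠ 0) :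
    ¬ U.Fact_hodgeRiemann20 := fun h =>
  h0 ((Submodule.eq_bot_iff _).mp (U.radC_inf_F2_eq_bot_of_hodgeRiemann20 h X hX) η (Submodule.mem_inf.mpr ⟨hN, hF⟩))

end Universe

end

end HodgeCM
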